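import Mathlib.Tactic
import HarnessLib
import HarnessLib.Audit.Tags
import Summits.CriticalPhenomena.PercolationContinuityZ3.Theorems.PercNearOneGluingNoHeavyLowerTailSahiAntichainDual

/-!
# Antichains, meets plus joins: a four-member antichain with only seven labels is a sunflower or a co-sunflower

Support file (seat `prim-masterthm-p1`, gen 37; `--supports stmt-CriticalPhenomena-4575`).  No `sorry`, no new definitions, standard
axioms.  Memo `run/shared/lean/prim/prim-masterthm/FROM-prim-masterthm-p1-g37-LINEAR-REDUCTION.md` §2 (classification lemma C4).

SETTING (files `…SahiAntichainSplit*`): `meets P` / `joins P` are the pairwise meets / joins of distinct members, `f P = #meets P + #joins P`.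
The kernel has `f P ≥ 7` for every four-member antichain (`seven_le_of_card_eq_four`, `…SplitSeven`).

NEW HERE ([this work], gen 37): the equality case.  **A four-member antichain with `f P ≤ 7` is a sunflower (all pairwise meets equal)
or a co-sunflower (all pairwise unions equal)** (`sunflower_or_cosunflower_of_card_eq_four`); equivalently every other four-member
antichain has `f P ≥ 8` (`eight_le_of_card_eq_four`).  This is the classification lemma «C4» of the threshold reduction
(`…SahiAntichainLinear`): it lets a four-member side with seven labels be treated by the kernel's (co)sunflower steps.
PROOF.  The heart is `four_le_card_meets_of_union_eq_union[']`: **two distinct pairs with the same join force four distinct meets.**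
(i) Shared member, `a ∪ b = a ∪ c`: then `b △ c ⊆ a`, so `a ∩ b ⊇ b \ c`, `a ∩ c ⊇ c \ b` and `a ∩ b, a ∩ c, b ∩ c` are pairwise distinct;
if the three meets with the fourth member `d` all fell among them, `b ∩ d ∈ {a ∩ b, b ∩ c}` and `c ∩ d ∈ {a ∩ c, b ∩ c}` and each of the
four combinations forces a containment (`b ⊆ a`, `c ⊆ d`, `b ⊆ d`, or a point of `b △ c` on the wrong side).  (ii) Disjoint pairs,
`a ∪ b = c ∪ d`: each member is the union of its two cross meets (`a = (a ∩ c) ∪ (a ∩ d)`, …), so any coincidence among the four cross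
meets `a ∩ c, a ∩ d, b ∩ c, b ∩ d` makes two members comparable or equal.  By complement duality two pairs with the same meet force four
joins.  Pigeonhole: `#joins ≤ 5` gives a coincidence among the six joins, hence `#meets ≥ 4`; dually; so `f ≤ 7` forces `#joins = 6,
#meets ≤ 1` (sunflower) or `#meets = 6, #joins ≤ 1` (co-sunflower).  Exhaustive data (`2^6`): the 490 four-member antichains with
seven labels are exactly the 4-(co)sunflowers; the value set of `(#meets, #joins)` is `{(1,6),(2,6),(3,6),(4,4),…}`.
HONEST FRAMING: unconditional; V5 itself remains OPEN. [this work]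
-/

namespace Summit.CriticalPhenomena.PercolationContinuityZ3.Theorems.SahiColouredDaykin

open Finset

variable {α : Type*} [DecidableEq α]

/-! ### 1. Four distinct elements -/

/-- Four pairwise distinct members of a finset give `4 ≤ #S`. [this work] -/
theorem four_le_card_of_mem {β : Type*} [DecidableEq β] {S : Finset β} {w x y z : β}
    (hw : w ∈ S) (hx : x ∈ S) (hy : y ∈ S) (hz : z ∈ S)
    (h1 : w ≠ x) (h2 : w ≠ y) (h3 : w ≠ z) (h4 : x ≠ y) (h5 : x ≠ z) (h6 : y ≠ z) : 4 ≤ #S := by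
  have hsub : ({w, x, y, z} : Finset β) ⊆ S := by
    intro t ht
    simp only [mem_insert, mem_singleton] at ht
    rcases ht with rfl | rfl | rfl | rfl <;> assumption
  have hcard : #({w, x, y, z} : Finset β) = 4 := by
    rw [card_insert_of_notMem, card_insert_of_notMem, card_pair h6]
    · simp only [mem_insert, mem_singleton, not_or]; exact ⟨h4, h5⟩
    · simp only [mem_insert, mem_singleton, not_or]; exact ⟨h1, h2, h3⟩
  calc 4 = #({w, x, y, z} : Finset β) := hcard.symm
    _ ≤ #S := card_le_card hsub

/-! ### 2. Two pairs with the same join force four meets -/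

section Core

variable {P : Finset (Finset α)} {a b c d : Finset α}

/-- Membership of a meet of two distinct members. [this work] -/
theorem inter_mem_meets (ha : a ∈ P) (hb : b ∈ P) (hab : a ≠ b) : a ∩ b ∈ meets P :=
  mem_meets_iff.2 ⟨a, ha, b, hb, hab, rfl⟩

/-- **Shared member.**  In an antichain, `a ∪ b = a ∪ c` for three distinct members `a, b, c` and a fourth member `d` force at least
four distinct pairwise meets. [this work] -/
theorem four_le_card_meets_of_union_eq_union (hanti : IsAntichain (· ⊆ ·) (P : Set (Finset α)))
    (ha : a ∈ P) (hb : b ∈ P) (hc : c ∈ P) (hd : d ∈ P)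
    (hab : a ≠ b) (hac : a ≠ c) (had : a ≠ d) (hbc : b ≠ c) (hbd : b ≠ d) (hcd : c ≠ d)
    (hu : a ∪ b = a ∪ c) : 4 ≤ #(meets P) := by
  have nba : ¬ b ⊆ a := hanti (mem_coe.2 hb) (mem_coe.2 ha) hab.symm
  have nbc : ¬ b ⊆ c := hanti (mem_coe.2 hb) (mem_coe.2 hc) hbc
  have ncb : ¬ c ⊆ b := hanti (mem_coe.2 hc) (mem_coe.2 hb) hbc.symm
  have nbd : ¬ b ⊆ d := hanti (mem_coe.2 hb) (mem_coe.2 hd) hbd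
  have ncd : ¬ c ⊆ d := hanti (mem_coe.2 hc) (mem_coe.2 hd) hcd
  obtain ⟨x, hxb, hxc⟩ := not_subset.1 nbc
  obtain ⟨y, hyc, hyb⟩ := not_subset.1 ncb
  -- `b △ c ⊆ a`
  have hbca : ∀ {z}, z ∈ b → z ∉ c → z ∈ a := by
    intro z hzb hzc
    have : z ∈ a ∪ c := by rw [← hu]; exact mem_union_right _ hzb
    rcases mem_union.1 this with h | h
    · exact h
    · exact absurd h hzc
  have hcba : ∀ {z}, z ∈ c → z ∉ b → z ∈ a := by
    intro z hzc hzb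
    have : z ∈ a ∪ b := by rw [hu]; exact mem_union_right _ hzc
    rcases mem_union.1 this with h | h
    · exact h
    · exact absurd h hzb
  have hxa : x ∈ a := hbca hxb hxc
  have hya : y ∈ a := hcba hyc hyb
  -- the three meets among `a, b, c`
  have hM1 : a ∩ b ∈ meets P := inter_mem_meets ha hb hab
  have hM2 : a ∩ c ∈ meets P := inter_mem_meets ha hc hac
  have hM3 : b ∩ c ∈ meets P := inter_mem_meets hb hc hbc
  have n12 : a ∩ b ≠ a ∩ c := by
    intro h; have : x ∈ a ∩ c := by rw [← h]; exact mem_inter.2 ⟨hxa, hxb⟩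
    exact hxc (mem_inter.1 this).2
  have n13 : a ∩ b ≠ b ∩ c := by
    intro h; have : x ∈ b ∩ c := by rw [← h]; exact mem_inter.2 ⟨hxa, hxb⟩
    exact hxc (mem_inter.1 this).2
  have n23 : a ∩ c ≠ b ∩ c := by
    intro h; have : y ∈ b ∩ c := by rw [← h]; exact mem_inter.2 ⟨hya, hyc⟩
    exact hyb (mem_inter.1 this).1
  -- the meets with `d`
  have hBd : b ∩ d ∈ meets P := inter_mem_meets hb hd hbd
  have hCd : c ∩ d ∈ meets P := inter_mem_meets hc hd hcd
  have hAd : a ∩ d ∈ meets P := inter_mem_meets ha hd had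
  have nBd2 : b ∩ d ≠ a ∩ c := by
    intro h; have : y ∈ b ∩ d := by rw [h]; exact mem_inter.2 ⟨hya, hyc⟩
    exact hyb (mem_inter.1 this).1
  have nCd1 : c ∩ d ≠ a ∩ b := by
    intro h; have : x ∈ c ∩ d := by rw [h]; exact mem_inter.2 ⟨hxa, hxb⟩
    exact hxc (mem_inter.1 this).1
  -- a fourth meet, by cases
  by_cases hBd1 : b ∩ d = a ∩ b
  · by_cases hCd3 : c ∩ d = b ∩ c
    · -- (iii) `b ⊆ d`
      exfalso; apply nbd
      intro z hzb
      by_cases hzc : z ∈ c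
      · have : z ∈ c ∩ d := by rw [hCd3]; exact mem_inter.2 ⟨hzb, hzc⟩
        exact (mem_inter.1 this).2
      · have : z ∈ b ∩ d := by rw [hBd1]; exact mem_inter.2 ⟨hbca hzb hzc, hzb⟩
        exact (mem_inter.1 this).2
    by_cases hCd2 : c ∩ d = a ∩ c
    · -- (iv) `a ∩ d` is the fourth meet
      have s1 : a ∩ b ⊆ a ∩ d := by
        intro z hz; have hz' : z ∈ b ∩ d := by rw [hBd1]; exact hz
        exact mem_inter.2 ⟨(mem_inter.1 hz).1, (mem_inter.1 hz').2⟩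
      have s2 : a ∩ c ⊆ a ∩ d := by
        intro z hz; have hz' : z ∈ c ∩ d := by rw [hCd2]; exact hz
        exact mem_inter.2 ⟨(mem_inter.1 hz).1, (mem_inter.1 hz').2⟩
      have nAd1 : a ∩ d ≠ a ∩ b := by
        intro h; have : y ∈ a ∩ b := by rw [← h]; exact s2 (mem_inter.2 ⟨hya, hyc⟩)
        exact hyb (mem_inter.1 this).2
      have nAd2 : a ∩ d ≠ a ∩ c := by
        intro h; have : x ∈ a ∩ c := by rw [← h]; exact s1 (mem_inter.2 ⟨hxa, hxb⟩)
        exact hxc (mem_inter.1 this).2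
      have nAd3 : a ∩ d ≠ b ∩ c := by
        intro h; have : x ∈ b ∩ c := by rw [← h]; exact s1 (mem_inter.2 ⟨hxa, hxb⟩)
        exact hxc (mem_inter.1 this).2
      exact four_le_card_of_mem hM1 hM2 hM3 hAd n12 n13 nAd1.symm n23 nAd2.symm nAd3.symm
    · exact four_le_card_of_mem hM1 hM2 hM3 hCd n12 n13 (Ne.symm nCd1) n23 (Ne.symm hCd2) (Ne.symm hCd3)
  by_cases hBd3 : b ∩ d = b ∩ c
  · by_cases hCd3 : c ∩ d = b ∩ c
    · -- (i) `a ∩ d` is new unless `b ⊆ a`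
      have nAd1 : a ∩ d ≠ a ∩ b := by
        intro h
        have : x ∈ a ∩ d := by rw [h]; exact mem_inter.2 ⟨hxa, hxb⟩
        have : x ∈ b ∩ d := mem_inter.2 ⟨hxb, (mem_inter.1 this).2⟩
        rw [hBd3] at this; exact hxc (mem_inter.1 this).2
      have nAd2 : a ∩ d ≠ a ∩ c := by
        intro h
        have : y ∈ a ∩ d := by rw [h]; exact mem_inter.2 ⟨hya, hyc⟩
        have : y ∈ c ∩ d := mem_inter.2 ⟨hyc, (mem_inter.1 this).2⟩
        rw [hCd3] at this; exact hyb (mem_inter.1 this).1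
      have nAd3 : a ∩ d ≠ b ∩ c := by
        intro h
        apply nba
        intro z hzb
        by_cases hzc : z ∈ c
        · have : z ∈ a ∩ d := by rw [h]; exact mem_inter.2 ⟨hzb, hzc⟩
          exact (mem_inter.1 this).1
        · exact hbca hzb hzc
      exact four_le_card_of_mem hM1 hM2 hM3 hAd n12 n13 nAd1.symm n23 nAd2.symm nAd3.symm
    by_cases hCd2 : c ∩ d = a ∩ c
    · -- (ii) `c ⊆ d`
      exfalso; apply ncd
      intro z hzc
      by_cases hzb : z ∈ b
      · have : z ∈ b ∩ d := by rw [hBd3]; exact mem_inter.2 ⟨hzb, hzc⟩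
        exact (mem_inter.1 this).2
      · have : z ∈ c ∩ d := by rw [hCd2]; exact mem_inter.2 ⟨hcba hzc hzb, hzc⟩
        exact (mem_inter.1 this).2
    · exact four_le_card_of_mem hM1 hM2 hM3 hCd n12 n13 (Ne.symm nCd1) n23 (Ne.symm hCd2) (Ne.symm hCd3)
  · exact four_le_card_of_mem hM1 hM2 hM3 hBd n12 n13 (Ne.symm hBd1) n23 (Ne.symm nBd2) (Ne.symm hBd3)

/-- **Disjoint pairs.**  In an antichain, `a ∪ b = c ∪ d` for four distinct members forces the four cross meets
`a ∩ c, a ∩ d, b ∩ c, b ∩ d` to be pairwise distinct, hence `4 ≤ #meets`. [this work] -/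
theorem four_le_card_meets_of_union_eq_union' (hanti : IsAntichain (· ⊆ ·) (P : Set (Finset α)))
    (ha : a ∈ P) (hb : b ∈ P) (hc : c ∈ P) (hd : d ∈ P)
    (_hab : a ≠ b) (hac : a ≠ c) (had : a ≠ d) (hbc : b ≠ c) (hbd : b ≠ d) (_hcd : c ≠ d)
    (hu : a ∪ b = c ∪ d) : 4 ≤ #(meets P) := by
  -- each member is the union of its two cross meets
  have dec : ∀ {p q s t : Finset α}, p ∪ q = s ∪ t → p = (p ∩ s) ∪ (p ∩ t) := by
    intro p q s t h
    rw [← inter_union_distrib_left]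
    refine (inter_eq_left.2 ?_).symm
    rw [← h]; exact subset_union_left
  have ea : a = (a ∩ c) ∪ (a ∩ d) := dec hu
  have eb : b = (b ∩ c) ∪ (b ∩ d) := dec (by rw [union_comm]; exact hu)
  have ec : c = (c ∩ a) ∪ (c ∩ b) := dec hu.symm
  have ed : d = (d ∩ a) ∪ (d ∩ b) := dec (by rw [union_comm]; exact hu.symm)
  have nac : ¬ a ⊆ c := hanti (mem_coe.2 ha) (mem_coe.2 hc) hac
  have nca : ¬ c ⊆ a := hanti (mem_coe.2 hc) (mem_coe.2 ha) hac.symm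
  have nbd : ¬ b ⊆ d := hanti (mem_coe.2 hb) (mem_coe.2 hd) hbd
  have ndb : ¬ d ⊆ b := hanti (mem_coe.2 hd) (mem_coe.2 hb) hbd.symm
  -- pairwise distinctness of the four cross meets
  have n1 : a ∩ c ≠ a ∩ d := by
    intro h; apply nac; rw [ea, ← h, union_idempotent]; exact inter_subset_right
  have n2 : a ∩ c ≠ b ∩ c := by
    intro h; apply nca; rw [ec, inter_comm c a, inter_comm c b, ← h, union_idempotent]; exact inter_subset_left
  have n3 : a ∩ c ≠ b ∩ d := by
    intro h; apply had
    calc a = a ∩ c ∪ a ∩ d := ea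
      _ = b ∩ d ∪ a ∩ d := by rw [h]
      _ = d ∩ a ∪ d ∩ b := by rw [inter_comm b d, inter_comm a d, union_comm]
      _ = d := ed.symm
  have n4 : a ∩ d ≠ b ∩ c := by
    intro h; apply hac
    calc a = a ∩ c ∪ a ∩ d := ea
      _ = a ∩ c ∪ b ∩ c := by rw [h]
      _ = c ∩ a ∪ c ∩ b := by rw [inter_comm a c, inter_comm b c]
      _ = c := ec.symm
  have n5 : a ∩ d ≠ b ∩ d := by
    intro h; apply ndb; rw [ed, inter_comm d a, inter_comm d b, h, union_idempotent]; exact inter_subset_left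
  have n6 : b ∩ c ≠ b ∩ d := by
    intro h; apply nbd; rw [eb, h, union_idempotent]; exact inter_subset_right
  exact four_le_card_of_mem (inter_mem_meets ha hc hac) (inter_mem_meets ha hd had) (inter_mem_meets hb hc hbc)
    (inter_mem_meets hb hd hbd) n1 n2 n3 n4 n5 n6

end Core

/-! ### 3. Pigeonhole: at most five joins force four meets; dually -/

/-- **At most five joins force at least four meets** (four-member antichain). [this work] -/
theorem four_le_card_meets_of_card_joins_le_five {P : Finset (Finset α)} (hanti : IsAntichain (· ⊆ ·) (P : Set (Finset α)))
    (h4 : #P = 4) (hJ : #(joins P) ≤ 5) : 4 ≤ #(meets P) := by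
  obtain ⟨a, b, c, d, hab, hac, had, hbc, hbd, hcd, hP⟩ := card_eq_four.1 h4
  have ha : a ∈ P := by rw [hP]; simp
  have hb : b ∈ P := by rw [hP]; simp
  have hc : c ∈ P := by rw [hP]; simp
  have hd : d ∈ P := by rw [hP]; simp
  have J : ∀ {p q : Finset α}, p ∈ P → q ∈ P → p ≠ q → p ∪ q ∈ joins P :=
    fun hp hq hpq => mem_joins_iff.2 ⟨_, hp, _, hq, hpq, rfl⟩
  -- shared-member coincidences, in the orientation of the core lemma
  have S := fun {p q s t : Finset α} (hp : p ∈ P) (hq : q ∈ P) (hs : s ∈ P) (ht : t ∈ P)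
      (hpq : p ≠ q) (hps : p ≠ s) (hpt : p ≠ t) (hqs : q ≠ s) (hqt : q ≠ t) (hst : s ≠ t) (h : p ∪ q = p ∪ s) =>
    four_le_card_meets_of_union_eq_union hanti hp hq hs ht hpq hps hpt hqs hqt hst h
  have D := fun {p q s t : Finset α} (hp : p ∈ P) (hq : q ∈ P) (hs : s ∈ P) (ht : t ∈ P)
      (hpq : p ≠ q) (hps : p ≠ s) (hpt : p ≠ t) (hqs : q ≠ s) (hqt : q ≠ t) (hst : s ≠ t) (h : p ∪ q = s ∪ t) =>
    four_le_card_meets_of_union_eq_union' hanti hp hq hs ht hpq hps hpt hqs hqt hst h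
  by_cases h1 : a ∪ b = a ∪ c
  · exact S ha hb hc hd hab hac had hbc hbd hcd h1
  by_cases h2 : a ∪ b = a ∪ d
  · exact S ha hb hd hc hab had hac hbd hbc hcd.symm h2
  by_cases h3 : a ∪ b = b ∪ c
  · exact S hb ha hc hd hab.symm hbc hbd hac had hcd (by rw [union_comm b a]; exact h3)
  by_cases h4' : a ∪ b = b ∪ d
  · exact S hb ha hd hc hab.symm hbd hbc had hac hcd.symm (by rw [union_comm b a]; exact h4')
  by_cases h5 : a ∪ b = c ∪ d
  · exact D ha hb hc hd hab hac had hbc hbd hcd h5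
  by_cases h6 : a ∪ c = a ∪ d
  · exact S ha hc hd hb hac had hab hcd hbc.symm hbd.symm h6
  by_cases h7 : a ∪ c = b ∪ c
  · exact S hc ha hb hd hac.symm hbc.symm hcd hab had hbd (by rw [union_comm c a, union_comm c b]; exact h7)
  by_cases h8 : a ∪ c = b ∪ d
  · exact D ha hc hb hd hac hab had hbc.symm hcd hbd h8
  by_cases h9 : a ∪ c = c ∪ d
  · exact S hc ha hd hb hac.symm hcd hbc.symm had hab hbd.symm (by rw [union_comm c a]; exact h9)
  by_cases h10 : a ∪ d = b ∪ c
  · exact D ha hd hb hc had hab hac hbd.symm hcd.symm hbc h10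
  by_cases h11 : a ∪ d = b ∪ d
  · exact S hd ha hb hc had.symm hbd.symm hcd.symm hab hac hbc (by rw [union_comm d a, union_comm d b]; exact h11)
  by_cases h12 : a ∪ d = c ∪ d
  · exact S hd ha hc hb had.symm hcd.symm hbd.symm hac hab hbc.symm (by rw [union_comm d a, union_comm d c]; exact h12)
  by_cases h13 : b ∪ c = b ∪ d
  · exact S hb hc hd ha hbc hbd hab.symm hcd hac.symm had.symm h13
  by_cases h14 : b ∪ c = c ∪ d
  · exact S hc hb hd ha hbc.symm hcd hac.symm hbd hab.symm had.symm (by rw [union_comm c b]; exact h14)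
  by_cases h15 : b ∪ d = c ∪ d
  · exact S hd hb hc ha hbd.symm hcd.symm had.symm hbc hab.symm hac.symm (by rw [union_comm d b, union_comm d c]; exact h15)
  -- all six joins distinct: `#joins ≥ 6`, contradiction
  exfalso
  have hsub : ({a ∪ b, a ∪ c, a ∪ d, b ∪ c, b ∪ d, c ∪ d} : Finset (Finset α)) ⊆ joins P := by
    intro W hW
    simp only [mem_insert, mem_singleton] at hW
    rcases hW with rfl | rfl | rfl | rfl | rfl | rfl
    · exact J ha hb hab
    · exact J ha hc hac
    · exact J ha hd had
    · exact J hb hc hbc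
    · exact J hb hd hbd
    · exact J hc hd hcd
  have hcard : #({a ∪ b, a ∪ c, a ∪ d, b ∪ c, b ∪ d, c ∪ d} : Finset (Finset α)) = 6 := by
    rw [card_insert_of_notMem, card_insert_of_notMem, card_insert_of_notMem, card_insert_of_notMem, card_pair h15]
    · simp only [mem_insert, mem_singleton, not_or]; exact ⟨h13, h14⟩
    · simp only [mem_insert, mem_singleton, not_or]; exact ⟨h10, h11, h12⟩
    · simp only [mem_insert, mem_singleton, not_or]; exact ⟨h6, h7, h8, h9⟩
    · simp only [mem_insert, mem_singleton, not_or]; exact ⟨h1, h2, h3, h4', h5⟩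
  have := card_le_card hsub
  omega

/-- **At most five meets force at least four joins** (four-member antichain), by complement duality. [this work] -/
theorem four_le_card_joins_of_card_meets_le_five {P : Finset (Finset α)} (hanti : IsAntichain (· ⊆ ·) (P : Set (Finset α)))
    (h4 : #P = 4) (hL : #(meets P) ≤ 5) : 4 ≤ #(joins P) := by
  set F := P.sup id with hF
  have hP : ∀ a ∈ P, a ⊆ F := fun a ha => le_sup (f := id) ha
  rw [← card_meets_image_compl hP]
  exact four_le_card_meets_of_card_joins_le_five (isAntichain_image_compl hanti hP) (by rw [card_image_compl hP, h4])
    (by rw [card_joins_image_compl hP]; exact hL)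

/-! ### 4. The classification -/

/-- All pairwise meets of `P` coincide when `#meets P ≤ 1`. [this work] -/
theorem exists_inter_eq_of_card_meets_le_one {P : Finset (Finset α)} (h : #(meets P) ≤ 1) (h2 : 2 ≤ #P) :
    ∃ K, ∀ a ∈ P, ∀ a' ∈ P, a ≠ a' → a ∩ a' = K := by
  obtain ⟨a, b, ha, hb, hab⟩ := one_lt_card_iff.1 (by omega : 1 < #P)
  refine ⟨a ∩ b, fun x hx y hy hxy => ?_⟩
  exact card_le_one.1 h _ (inter_mem_meets hx hy hxy) _ (inter_mem_meets ha hb hab)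

/-- All pairwise joins of `P` coincide when `#joins P ≤ 1`. [this work] -/
theorem exists_union_eq_of_card_joins_le_one {P : Finset (Finset α)} (h : #(joins P) ≤ 1) (h2 : 2 ≤ #P) :
    ∃ U, ∀ a ∈ P, ∀ a' ∈ P, a ≠ a' → a ∪ a' = U := by
  obtain ⟨a, b, ha, hb, hab⟩ := one_lt_card_iff.1 (by omega : 1 < #P)
  refine ⟨a ∪ b, fun x hx y hy hxy => ?_⟩
  exact card_le_one.1 h _ (mem_joins_iff.2 ⟨x, hx, y, hy, hxy, rfl⟩) _ (mem_joins_iff.2 ⟨a, ha, b, hb, hab, rfl⟩)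

/-- **C4.**  A four-member antichain with at most seven labels is a sunflower or a co-sunflower. [this work] -/
theorem sunflower_or_cosunflower_of_card_eq_four {P : Finset (Finset α)} (hanti : IsAntichain (· ⊆ ·) (P : Set (Finset α)))
    (h4 : #P = 4) (h7 : #(meets P) + #(joins P) ≤ 7) :
    (∃ K, ∀ a ∈ P, ∀ a' ∈ P, a ≠ a' → a ∩ a' = K) ∨ (∃ U, ∀ a ∈ P, ∀ a' ∈ P, a ≠ a' → a ∪ a' = U) := by
  by_cases hJ : #(joins P) ≤ 5
  · have hL4 := four_le_card_meets_of_card_joins_le_five hanti h4 hJ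
    by_cases hL : #(meets P) ≤ 5
    · have hJ4 := four_le_card_joins_of_card_meets_le_five hanti h4 hL
      omega
    · -- `#meets ≥ 6`, so `#joins ≤ 1`
      exact Or.inr (exists_union_eq_of_card_joins_le_one (by omega) (by omega))
  · -- `#joins ≥ 6`, so `#meets ≤ 1`
    exact Or.inl (exists_inter_eq_of_card_meets_le_one (by omega) (by omega))

/-- **C4, contrapositive form.**  A four-member antichain that is neither a sunflower nor a co-sunflower has at least eight labels. [this work] -/
theorem eight_le_of_card_eq_four {P : Finset (Finset α)} (hanti : IsAntichain (· ⊆ ·) (P : Set (Finset α))) (h4 : #P = 4)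
    (hK : ¬ ∃ K, ∀ a ∈ P, ∀ a' ∈ P, a ≠ a' → a ∩ a' = K) (hU : ¬ ∃ U, ∀ a ∈ P, ∀ a' ∈ P, a ≠ a' → a ∪ a' = U) :
    8 ≤ #(meets P) + #(joins P) := by
  by_contra hlt
  rcases sunflower_or_cosunflower_of_card_eq_four hanti h4 (by omega) with h | h
  · exact hK h
  · exact hU h

end Summit.CriticalPhenomena.PercolationContinuityZ3.Theorems.SahiColouredDaykin
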